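import Summits.AnomalousDissipation.AnomalousDissipation.Theorems.SoloInformedDriftRateCeiling

/-!
# Drift states III: Diophantine drift — uniformly bounded enstrophy, `D(ν) ≤ C ν` (solo-informed)

For the `2½`-dimensional constant-drift states `U_ν = (c, R_ν) ∘ π` of `SoloInformedDriftStates`
(drift `c ∈ ℝ²`, frequencies `k_n ≠ 0`, rapidly decaying force amplitudes `w_n`, resonance
denominators `σ_n = 2π c·k_n`), the companion file `SoloInformedDriftRateCeiling` proves the
ceiling `ν‖∇U_ν‖₂² ≤ C_θ ν^θ` for every `θ < 1` under finite inviscid energy.  This file records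
the endpoint `θ = 1` under the summability `B = ∑_n √λ_n |w_n|/|σ_n| < ∞` (`λ_n = 4π²|k_n|²`):

* `summable_gradAmp_of_diophantine` — `B < ∞` holds for EVERY smooth force profile as soon as
  the drift direction is **Diophantine**, `|σ_n| (2π(1+|k_n|²))^p ≥ γ > 0` (small divisors beaten
  by rapid decay);
* `dissipation_UD_le_linear` — `ν ‖∇U_ν‖₂² ≤ 2 B² ν` for all `ν > 0`;
* `toReal_eGradNormSq_UD_le` — the enstrophy is bounded UNIFORMLY in the viscosity,
  `‖∇U_ν‖₂² ≤ 2 B²`: the inviscid limit `U_0 = (c, R_0)`, `R_0 = ∑ M_{k_n}(w_n/σ_n)`, is a smooth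
  steady Euler flow and `U_ν → U_0` without any loss of derivatives;
* `driftClass_meanDissipation_le_linear` — in the vocabulary of `Literature.Turb.ZerothLaw`: along
  every viscosity sequence the family consists of global Leray–Hopf solutions under ONE smooth
  force with `meanEnergy ≤ |c|² + A²` and `meanDissipation(ν_j, u_j) ≤ 2B² ν_j`.

Together with the universal laminar floor `meanDissipation ≥ 4π²ν(⟨‖u‖²⟩ - ‖m‖²)`
(`SoloInformedLaminarFloor`), the Diophantine drift class sits exactly at the bottom `D ≍ ν` of
the window `[c ν, ε]` in which a zeroth-law witness must live: the floor's ORDER is attained by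
exact fixed-force bounded-energy Navier–Stokes families, so no improvement of the exponent `1`
in the floor is possible without further hypotheses on the family.

References: A. Cheskidov, arXiv:2311.04182 §6 [Cheskidov2023]; E. Bruè, C. De Lellis,
CMP 400 (2023) §3 [BrueDeLellis2023]; C. R. Doering, C. Foias, J. Fluid Mech. 467 (2002) §3
[DoeringFoias2002].
-/

noncomputable section

open MeasureTheory Filter Topology Set UnitAddTorus
open scoped ENNReal NNReal InnerProductSpace Real ComplexConjugate

namespace Summit.AnomalousDissipation.AnomalousDissipation.Theorems

open Literature.Analysis.FunctionSpaces Literature.Analysis.FunctionSpaces.Torus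
  Literature.Analysis.FluidPDE

variable {c : EuclideanSpace ℝ (Fin 2)} {k : ℕ → Fin 2 → ℤ} {w : ℕ → ℂ}

/-! ## Diophantine drift directions -/

/-- A Diophantine lower bound `γ ≤ |σ_n| W_n^p` with `γ > 0` forces non-resonance `σ_n ≠ 0`.
[folklore] -/
theorem σD_ne_zero_of_diophantine {γ : ℝ} {p : ℕ} (hγ : 0 < γ)
    (hdio : ∀ n, γ ≤ |σD c k n| * (2 * Real.pi * (1 + freqNormSq (k n))) ^ p) (n : ℕ) :
    σD c k n ≠ 0 := by
  intro h
  have := hdio n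
  rw [h, abs_zero, zero_mul] at this
  exact absurd this (not_le.2 hγ)

/-- **Small divisors beaten by rapid decay.**  For a Diophantine drift direction,
`|σ_n| (2π(1+|k_n|²))^p ≥ γ > 0`, and ANY rapidly decaying force amplitudes:
`B = ∑_n √λ_n |w_n|/|σ_n| < ∞`. [folklore] -/
theorem summable_gradAmp_of_diophantine (hw : RapidDecay k w) {γ : ℝ} {p : ℕ} (hγ : 0 < γ)
    (hdio : ∀ n, γ ≤ |σD c k n| * (2 * Real.pi * (1 + freqNormSq (k n))) ^ p) :
    Summable fun n => Real.sqrt (lamD k n) * ‖w n‖ / |σD c k n| := by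
  have hσ := σD_ne_zero_of_diophantine hγ hdio
  refine Summable.of_nonneg_of_le (fun n => by positivity) (fun n => ?_)
    ((hw (p + 1)).div_const γ)
  have hσp : 0 < |σD c k n| := abs_pos.2 (hσ n)
  have hW : 0 ≤ 2 * Real.pi * (1 + freqNormSq (k n)) := (zero_le_one.trans (one_le_weightD n))
  rw [div_le_div_iff₀ hσp hγ]
  have h1 : Real.sqrt (lamD k n) * ‖w n‖ * γ ≤
      2 * Real.pi * (1 + freqNormSq (k n)) * ‖w n‖ * γ :=
    mul_le_mul_of_nonneg_right (mul_le_mul_of_nonneg_right (sqrt_lamD_le n) (norm_nonneg _))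
      hγ.le
  have h2 : 2 * Real.pi * (1 + freqNormSq (k n)) * ‖w n‖ * γ ≤
      2 * Real.pi * (1 + freqNormSq (k n)) * ‖w n‖ *
        (|σD c k n| * (2 * Real.pi * (1 + freqNormSq (k n))) ^ p) :=
    mul_le_mul_of_nonneg_left (hdio n) (mul_nonneg hW (norm_nonneg _))
  calc Real.sqrt (lamD k n) * ‖w n‖ * γ ≤ _ := h1.trans h2
    _ = ‖w n‖ * (2 * Real.pi * (1 + freqNormSq (k n))) ^ (p + 1) * |σD c k n| := by
        rw [pow_succ]; ring

/-- `B < ∞` implies `A = ∑_n |w_n|/|σ_n| < ∞` (`λ_n ≥ 1`). [folklore] -/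
theorem summable_amp_of_summable_gradAmp (hk : ∀ n, k n ≠ 0)
    (hB : Summable fun n => Real.sqrt (lamD k n) * ‖w n‖ / |σD c k n|) :
    Summable fun n => ‖w n‖ / |σD c k n| := by
  refine Summable.of_nonneg_of_le (fun n => by positivity) (fun n => ?_) hB
  rw [mul_div_assoc]
  exact le_mul_of_one_le_left (by positivity) (Real.one_le_sqrt.2 (one_le_lamD (hk n)))

/-! ## The `θ = 1` ceiling -/

/-- **Linear dissipation ceiling**: under `B = ∑_n √λ_n |w_n|/|σ_n| < ∞`,
`ν ‖∇U_ν‖₂² ≤ 2 B² ν` for every `ν > 0`. [cite: Cheskidov2023, §6] -/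
theorem dissipation_UD_le_linear {ν : ℝ} (hν : 0 < ν) (hk : ∀ n, k n ≠ 0) (hw : RapidDecay k w)
    (hσ : ∀ n, σD c k n ≠ 0)
    (hB : Summable fun n => Real.sqrt (lamD k n) * ‖w n‖ / |σD c k n|) :
    ν * (eGradNormSq (UD c k w ν)).toReal ≤
      2 * (∑' n, Real.sqrt (lamD k n) * ‖w n‖ / |σD c k n|) ^ 2 * ν := by
  have h1 := dissipation_UD_le (c := c) hν hk hw
  have hle : ∀ n, Real.sqrt ν * (Real.sqrt (lamD k n) * ‖zD c k w ν n‖) ≤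
      Real.sqrt ν * (Real.sqrt (lamD k n) * ‖w n‖ / |σD c k n|) := fun n => by
    refine mul_le_mul_of_nonneg_left ?_ (Real.sqrt_nonneg _)
    rw [mul_div_assoc]
    exact mul_le_mul_of_nonneg_left (norm_zD_le (hσ n) ν) (Real.sqrt_nonneg _)
  have hsum : (∑' n, Real.sqrt ν * (Real.sqrt (lamD k n) * ‖zD c k w ν n‖)) ≤
      ∑' n, Real.sqrt ν * (Real.sqrt (lamD k n) * ‖w n‖ / |σD c k n|) :=
    ((summable_gradAmpD hν hk hw).mul_left _).tsum_le_tsum hle (hB.mul_left _)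
  have h0 : 0 ≤ ∑' n, Real.sqrt ν * (Real.sqrt (lamD k n) * ‖zD c k w ν n‖) :=
    tsum_nonneg fun n => by positivity
  calc ν * (eGradNormSq (UD c k w ν)).toReal
      ≤ 2 * (∑' n, Real.sqrt ν * (Real.sqrt (lamD k n) * ‖zD c k w ν n‖)) ^ 2 := h1
    _ ≤ 2 * (∑' n, Real.sqrt ν * (Real.sqrt (lamD k n) * ‖w n‖ / |σD c k n|)) ^ 2 :=
        mul_le_mul_of_nonneg_left (pow_le_pow_left₀ h0 hsum 2) zero_le_two
    _ = 2 * (∑' n, Real.sqrt (lamD k n) * ‖w n‖ / |σD c k n|) ^ 2 * ν := by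
        rw [tsum_mul_left, mul_pow, Real.sq_sqrt hν.le]; ring

/-- **Uniformly bounded enstrophy**: `‖∇U_ν‖₂² ≤ 2 B²` for every `ν > 0`.
[cite: Cheskidov2023, §6] -/
theorem toReal_eGradNormSq_UD_le {ν : ℝ} (hν : 0 < ν) (hk : ∀ n, k n ≠ 0) (hw : RapidDecay k w)
    (hσ : ∀ n, σD c k n ≠ 0)
    (hB : Summable fun n => Real.sqrt (lamD k n) * ‖w n‖ / |σD c k n|) :
    (eGradNormSq (UD c k w ν)).toReal ≤
      2 * (∑' n, Real.sqrt (lamD k n) * ‖w n‖ / |σD c k n|) ^ 2 := by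
  have h := dissipation_UD_le_linear (c := c) hν hk hw hσ hB
  rw [← mul_comm ν] at h
  exact le_of_mul_le_mul_left h hν

/-- **Diophantine drift, any smooth profile**: there is `C` with `‖∇U_ν‖₂² ≤ C` and
`ν‖∇U_ν‖₂² ≤ C ν` for all `ν > 0`. [cite: Cheskidov2023, §6] -/
theorem dissipation_UD_le_linear_of_diophantine (hk : ∀ n, k n ≠ 0) (hw : RapidDecay k w)
    {γ : ℝ} {p : ℕ} (hγ : 0 < γ)
    (hdio : ∀ n, γ ≤ |σD c k n| * (2 * Real.pi * (1 + freqNormSq (k n))) ^ p) :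
    ∃ C : ℝ, ∀ ν : ℝ, 0 < ν →
      (eGradNormSq (UD c k w ν)).toReal ≤ C ∧ ν * (eGradNormSq (UD c k w ν)).toReal ≤ C * ν :=
  ⟨2 * (∑' n, Real.sqrt (lamD k n) * ‖w n‖ / |σD c k n|) ^ 2, fun _ hν =>
    ⟨toReal_eGradNormSq_UD_le hν hk hw (σD_ne_zero_of_diophantine hγ hdio)
        (summable_gradAmp_of_diophantine hw hγ hdio),
      dissipation_UD_le_linear hν hk hw (σD_ne_zero_of_diophantine hγ hdio)
        (summable_gradAmp_of_diophantine hw hγ hdio)⟩⟩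

/-! ## In the vocabulary of the zeroth law -/

/-- **The drift class at the bottom of the window.**  Under `B < ∞`: for every viscosity
sequence `ν_j > 0` the steady fields `u_j = U_{ν_j}` are global Leray–Hopf solutions under the
ONE force `f = fD k w`, with `meanEnergy(u_j) ≤ |c|² + A²` and
`meanDissipation(ν_j, u_j) ≤ 2 B² ν_j` — dissipation of laminar ORDER `ν_j`, matching the
universal floor `≳ ν_j` of `SoloInformedLaminarFloor` and missing the zeroth law's `≥ ε` by the
full factor `ν_j`. [folklore] -/
theorem driftClass_meanDissipation_le_linear (hk : ∀ n, k n ≠ 0) (hw : RapidDecay k w)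
    (hσ : ∀ n, σD c k n ≠ 0)
    (hB : Summable fun n => Real.sqrt (lamD k n) * ‖w n‖ / |σD c k n|) (ν : ℕ → ℝ)
    (hν : ∀ j, 0 < ν j) (j : ℕ) :
    Torus.IsGlobalLerayHopf (ν j) (fun _ => fD k w) (UD c k w (ν j)) (fun _ => UD c k w (ν j)) ∧
      meanEnergy (fun _ : ℝ => UD c k w (ν j)) ≤ ‖c‖ ^ 2 + (∑' n, ‖w n‖ / |σD c k n|) ^ 2 ∧
      meanDissipation (ν j) (fun _ : ℝ => UD c k w (ν j)) ≤
        2 * (∑' n, Real.sqrt (lamD k n) * ‖w n‖ / |σD c k n|) ^ 2 * ν j := by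
  have hA := summable_amp_of_summable_gradAmp hk hB
  refine ⟨(isClassicalNSSolutionOn_UD (hν j) hk hw hσ).isGlobalLerayHopf, ?_, ?_⟩
  · rw [meanEnergy_eq_longTimeAvgSup, longTimeAvgSup_of_eq_const fun t _ => rfl]
    exact integral_norm_sq_UD_le (hν j) hk hw hσ hA
  · rw [meanDissipation_of_const]; exact dissipation_UD_le_linear (hν j) hk hw hσ hB

/-- **Diophantine version**: for a Diophantine drift direction and ANY smooth force profile
there is `C` such that every viscosity sequence gives a fixed-force bounded-energy global
Leray–Hopf family with `meanDissipation(ν_j, u_j) ≤ C ν_j`. [folklore] -/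
theorem driftClass_meanDissipation_le_linear_of_diophantine (hk : ∀ n, k n ≠ 0)
    (hw : RapidDecay k w) {γ : ℝ} {p : ℕ} (hγ : 0 < γ)
    (hdio : ∀ n, γ ≤ |σD c k n| * (2 * Real.pi * (1 + freqNormSq (k n))) ^ p) :
    ∃ C E : ℝ, ∀ ν : ℕ → ℝ, (∀ j, 0 < ν j) → ∀ j,
      Torus.IsGlobalLerayHopf (ν j) (fun _ => fD k w) (UD c k w (ν j)) (fun _ => UD c k w (ν j)) ∧
      meanEnergy (fun _ : ℝ => UD c k w (ν j)) ≤ E ∧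
      meanDissipation (ν j) (fun _ : ℝ => UD c k w (ν j)) ≤ C * ν j :=
  ⟨2 * (∑' n, Real.sqrt (lamD k n) * ‖w n‖ / |σD c k n|) ^ 2,
    ‖c‖ ^ 2 + (∑' n, ‖w n‖ / |σD c k n|) ^ 2, fun ν hν j =>
    driftClass_meanDissipation_le_linear hk hw (σD_ne_zero_of_diophantine hγ hdio)
      (summable_gradAmp_of_diophantine hw hγ hdio) ν hν j⟩

end Summit.AnomalousDissipation.AnomalousDissipation.Theorems

end
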